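import Summits.AnomalousDissipation.AnomalousDissipation.Theorems.EnsembleRigidityGPTameDefectFloorParityForm2Tools
import Literature.Analysis.FluidPDE.EnergySpaceTorusProofs
import HarnessLib

/-!
# Stub `stub_gpParityForm2` of line `Sketch` (crux stmt-AnomalousDissipation-17938, `EnsembleRigidity.GPTameDefectFloor`) — the `1/12` enstrophy certificate of `f_GP` (exact `1–2` block)

For the Galloway–Proctor force `f_GP = (sin 2πx₂, sin 2πx₀, sin 2πx₁)` on `T³` and every `v` in the
energy space `H` (`L²`, weakly divergence free, mean zero) with finite enstrophy
`‖∇v‖² = Torus.eGradNormSq v < ∞` we prove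

  `∫ (v ⊗ v) : ∇f_GP = Torus.inertialPairing v f_GP ≥ -(1/12) ‖∇v‖²`,

improving the parity constant `√2/(4π) ≈ 0.1125` of `…ParityForm.lean` (horizon `G₁ < 13.33`) to
`1/12` (horizon `G₁ < 18`); the sharp constant is the energy-stability eigenvalue `≈ 0.0583`.

Proof. As in the parity file, `⟪∇f_GP(x) u, u⟫ = 2π Σⱼ cos(2πxⱼ) uⱼ uⱼ₊₁` and the one-shift Parseval
identity give `I(u) = 2π Σⱼ Σₖ Re(conj ûⱼ(k - eⱼ) ûⱼ₊₁(k))`. Each term is bounded by weighted AM–GM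
`Re(conj a b) ≥ -(α|a|² + β|b|²)/2`, `αβ ≥ 1`, with *edge-dependent* weights `α = W(k - eⱼ, k)`,
`β = W(k, k - eⱼ)` from `form2_weight_exists` (Tools file): `|p|²/2` on shells `|p|² ≥ 3`, `2/|p'|²`
against such a partner, `13/25 ↔ 25/13` on the `24` edges between shell `1` and shell `2`. Summing
(`form2_integral_cos_mul_mul_ge`, `form2_pairing_ge`) gives `-I(u) ≤ π Σ_p F(p)` with the charge
`F(p) = Σ_m (W(p, p + e_m)|û_m(p)|² + W(p, p - e_m)|û_{m+1}(p)|²)`, and `form2_budget` bounds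
`Σ_p F(p) ≤ (π/3) Σ_p |p|² ‖û(p)‖² = ‖∇u‖²/(12π)`: pointwise off shell `2`, and on shell `2` after
symmetrising `p ↔ -p` (`û(-p) = conj û(p)`, `Torus.mFourierCoeff_ofReal_comp`) and using the
Fourier-side divergence-free constraint `p · û(p) = 0`
(`Torus.IsWeaklyDivFree.sum_mul_mFourierCoeff_eq_zero`, `Torus.mem_energySpace_iff_holds`), which
equalises the two in-plane components of `û(p)` — the Leray halving that makes the `1–2` block exact.
References: FMRT 2001, Ch. IV (the form `b`); Constantin–Foias 1988, Ch. 4 (4.33);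
Grafakos 2014, Prop. 3.2.7 (3) (Parseval on `Tⁿ`).
-/

-- `Summit.<Summit>.<Problem>` is the tree's mandated summit-side namespace (CONVENTIONS §2); single-conjunct summit, duplicate deliberate.
set_option linter.dupNamespace false

noncomputable section

namespace Summit.AnomalousDissipation.AnomalousDissipation.Theorems.EnsembleRigidity.GPTameDefectFloor

open MeasureTheory Filter Topology UnitAddTorus
open scoped InnerProductSpace RealInnerProductSpace ENNReal NNReal
open Literature.Analysis.FunctionSpaces Literature.Analysis.FluidPDE
open Summit.AnomalousDissipation.AnomalousDissipation.Theorems.EnsembleRigidity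

/-- Local notation: real vector fields on `T³`. -/
local notation "Vec3" => (UnitAddTorus (Fin 3)) → (EuclideanSpace ℝ (Fin 3))
/-- Local notation: `L²(T³; ℝ³)`. -/
local notation "L2" => (Lp (EuclideanSpace ℝ (Fin 3)) 2 (volume : Measure (UnitAddTorus (Fin 3))))
/-- Local notation: the energy space `H`. -/
local notation "H3" => (Torus.energySpace (Fin 3))

/-! ## Weighted AM–GM and the one-shift Parseval bound with edge weights -/

/-- Weighted AM–GM with a slack product: for complex `a`, `b` and weights `p ≥ 0`, `q` with
`p q ≥ 1`, `Re(conj(a) b) ≥ -(p |a|² + q |b|²)/2`. [folklore] -/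
theorem form2_re_conj_mul_ge (a b : ℂ) {p q : ℝ} (hp : 0 ≤ p) (hpq : 1 ≤ p * q) :
    -((p * ‖a‖ ^ 2 + q * ‖b‖ ^ 2) / 2) ≤ (starRingEnd ℂ a * b).re := by
  have h1 : -(‖a‖ * ‖b‖) ≤ (starRingEnd ℂ a * b).re := by
    have h := Complex.abs_re_le_norm (starRingEnd ℂ a * b)
    rw [norm_mul, Complex.norm_conj] at h
    exact (abs_le.1 h).1
  have hp0 : 0 < p := by
    rcases hp.lt_or_eq with h | h
    · exact h
    · rw [← h, zero_mul] at hpq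
      norm_num at hpq
  have key : p * (p * ‖a‖ ^ 2 + q * ‖b‖ ^ 2 - 2 * (‖a‖ * ‖b‖)) =
      (p * ‖a‖ - ‖b‖) ^ 2 + (p * q - 1) * ‖b‖ ^ 2 := by ring
  have h2 : 0 ≤ p * ‖a‖ ^ 2 + q * ‖b‖ ^ 2 - 2 * (‖a‖ * ‖b‖) := by
    by_contra h
    have h3 : p * (p * ‖a‖ ^ 2 + q * ‖b‖ ^ 2 - 2 * (‖a‖ * ‖b‖)) < 0 :=
      mul_neg_of_pos_of_neg hp0 (not_le.1 h)
    rw [key] at h3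
    exact absurd h3 (not_lt.2 (add_nonneg (sq_nonneg _)
      (mul_nonneg (by linarith) (sq_nonneg _))))
  linarith

/-- **One-shift Parseval with edge weights.** For a weight `W ≥ 0` on pairs of lattice points with
`W(k - eⱼ, k) W(k, k - eⱼ) ≥ 1` and real `g, h ∈ L²(T³)` with
`Σ_p W(p, p + eⱼ)|ĝ(p)|² = S_g`, `Σₖ W(k, k - eⱼ)|ĥ(k)|² = S_h`: `∫ cos(2πxⱼ) g h ≥ -(S_g + S_h)/2`.
Indeed `∫ cos(2πxⱼ) g h = Σₖ Re(conj ĝ(k - eⱼ) ĥ(k))` (polarised Parseval for `(eⱼ g, h)`,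
`𝓕(eⱼ g)(k) = ĝ(k - eⱼ)`) and termwise weighted AM–GM with the weights of the edge `(k - eⱼ, k)`.
[folklore] -/
theorem form2_integral_cos_mul_mul_ge (W : (Fin 3 → ℤ) → (Fin 3 → ℤ) → ℝ)
    (hW0 : ∀ p q, 0 ≤ W p q)
    (hW1 : ∀ (k : Fin 3 → ℤ) (j : Fin 3), 1 ≤ W (k - Pi.single j 1) k * W k (k - Pi.single j 1))
    {g h : UnitAddTorus (Fin 3) → ℝ} (hg : MemLp g 2 volume) (hh : MemLp h 2 volume) (j : Fin 3)
    {Sg Sh : ℝ}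
    (hSg : HasSum (fun p => W p (p + Pi.single j 1) * ‖mFourierCoeff (fun x => (g x : ℂ)) p‖ ^ 2) Sg)
    (hSh : HasSum (fun k => W k (k - Pi.single j 1) * ‖mFourierCoeff (fun x => (h x : ℂ)) k‖ ^ 2) Sh) :
    -((Sg + Sh) / 2) ≤ ∫ x, (mFourier (Pi.single j (1 : ℤ)) x).re * (g x * h x) := by
  have hGm : MemLp (fun x => (g x : ℂ)) 2 volume := Complex.ofRealCLM.comp_memLp' hg
  have hHm : MemLp (fun x => (h x : ℂ)) 2 volume := Complex.ofRealCLM.comp_memLp' hh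
  -- the modulated function `eⱼ • g`
  have hMm : MemLp (fun x => mFourier (Pi.single j (1 : ℤ)) x • (g x : ℂ)) 2 volume := by
    refine hGm.of_le ((mFourier _).continuous.aestronglyMeasurable.smul hGm.1)
      (ae_of_all _ fun x => ?_)
    rw [norm_smul]
    calc ‖mFourier (Pi.single j (1 : ℤ)) x‖ * ‖(g x : ℂ)‖ ≤ 1 * ‖(g x : ℂ)‖ :=
          mul_le_mul_of_nonneg_right
            (((mFourier _).norm_coe_le_norm x).trans_eq mFourier_norm) (norm_nonneg _)
      _ = ‖(g x : ℂ)‖ := one_mul _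
  -- polarised Parseval for `(eⱼ • g, h)` with the shifted coefficients, real parts
  have hP := Torus.hasSum_conj_mul_mFourierCoeff hMm hHm
  simp only [Torus.mFourierCoeff_mFourier_smul] at hP
  have hR := Complex.hasSum_re hP
  -- the integral is the real part of `∫ conj(eⱼ g) h`
  have hptw : ∀ x, starRingEnd ℂ (mFourier (Pi.single j (1 : ℤ)) x • (g x : ℂ)) * (h x : ℂ) =
      mFourier (-Pi.single j (1 : ℤ)) x * ((g * h) x : ℂ) := fun x => by
    simp only [mFourier_neg, smul_eq_mul, map_mul, Complex.conj_ofReal, Pi.mul_apply,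
      Complex.ofReal_mul]
    ring
  have hint : Integrable (fun x => mFourier (-Pi.single j (1 : ℤ)) x * ((g * h) x : ℂ)) volume :=
    (hg.integrable_mul hh).ofReal.bdd_mul (c := 1) (mFourier _).continuous.aestronglyMeasurable
      (ae_of_all _ fun x => ((mFourier _).norm_coe_le_norm x).trans_eq mFourier_norm)
  have hval : (∫ x, starRingEnd ℂ (mFourier (Pi.single j (1 : ℤ)) x • (g x : ℂ)) * (h x : ℂ)).re =
      ∫ x, (mFourier (Pi.single j (1 : ℤ)) x).re * (g x * h x) := by
    simp_rw [hptw]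
    have h1 := integral_re hint
    simp only [RCLike.re_to_complex] at h1
    rw [← h1]
    refine integral_congr_ae (ae_of_all _ fun x => ?_)
    simp [mFourier_neg, Complex.mul_re]
  rw [hval] at hR
  -- the lower series: re-index the `g`-sum by the shift `k ↦ k - eⱼ`
  have hSg' : HasSum (fun k : Fin 3 → ℤ => W (k - Pi.single j 1) k *
      ‖mFourierCoeff (fun x => (g x : ℂ)) (k - Pi.single j 1)‖ ^ 2) Sg := by
    have h0 := (Equiv.subRight (Pi.single j (1 : ℤ))).hasSum_iff.2 hSg
    simpa only [Function.comp_def, Equiv.subRight_apply, sub_add_cancel] using h0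
  have hF := ((hSg'.add hSh).div_const 2).neg
  exact hasSum_le (fun k => form2_re_conj_mul_ge _ _ (hW0 _ _) (hW1 k j)) hF hR

/-! ## The pairing against `f_GP`: the charge series -/

/-- **Step A (edge weights).** For `u ∈ L²(T³; ℝ³)` and an edge weight `W` as above, with
`Aⱼ = Σ_p W(p, p + eⱼ)|ûⱼ(p)|²` and `Bⱼ = Σ_p W(p, p - eⱼ)|ûⱼ₊₁(p)|²`:
`∫ ⟪∇f_GP u, u⟫ ≥ -π Σⱼ (Aⱼ + Bⱼ)` (the three cosine-weighted products `uⱼ uⱼ₊₁`). [folklore] -/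
theorem form2_pairing_ge (W : (Fin 3 → ℤ) → (Fin 3 → ℤ) → ℝ) (hW0 : ∀ p q, 0 ≤ W p q)
    (hW1 : ∀ (k : Fin 3 → ℤ) (j : Fin 3), 1 ≤ W (k - Pi.single j 1) k * W k (k - Pi.single j 1))
    {u : Vec3} (hu : MemLp u 2 volume) {A B : Fin 3 → ℝ}
    (hA : ∀ j, HasSum (fun p => W p (p + Pi.single j 1) *
      ‖mFourierCoeff (fun x => (u x j : ℂ)) p‖ ^ 2) (A j))
    (hB : ∀ j, HasSum (fun p => W p (p - Pi.single j 1) *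
      ‖mFourierCoeff (fun x => (u x (j + 1) : ℂ)) p‖ ^ 2) (B j)) :
    -(Real.pi * ∑ j, (A j + B j)) ≤ ∫ x, ⟪Torus.fderiv gpForce x (u x), u x⟫_ℝ := by
  have huc : ∀ i : Fin 3, MemLp (fun x => u x i) 2 volume := fun i => hu.eval_piLp i
  have hB0 := hB 0
  have hB1 := hB 1
  have hB2 := hB 2
  simp only [zero_add, form2_fin_succ] at hB0 hB1 hB2
  have h20 := form2_integral_cos_mul_mul_ge W hW0 hW1 (huc 2) (huc 0) 2 (hA 2) hB2
  have h01 := form2_integral_cos_mul_mul_ge W hW0 hW1 (huc 0) (huc 1) 0 (hA 0) hB0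
  have h12 := form2_integral_cos_mul_mul_ge W hW0 hW1 (huc 1) (huc 2) 1 (hA 1) hB1
  have i20 := parity_integrable_cos_mul_mul (huc 2) (huc 0) (Pi.single (2 : Fin 3) (1 : ℤ))
  have i01 := parity_integrable_cos_mul_mul (huc 0) (huc 1) (Pi.single (0 : Fin 3) (1 : ℤ))
  have i12 := parity_integrable_cos_mul_mul (huc 1) (huc 2) (Pi.single (1 : Fin 3) (1 : ℤ))
  have i2001 : Integrable (fun x =>
      (mFourier (Pi.single (2 : Fin 3) (1 : ℤ)) x).re * (u x 2 * u x 0) +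
        (mFourier (Pi.single (0 : Fin 3) (1 : ℤ)) x).re * (u x 0 * u x 1)) volume := i20.add i01
  simp_rw [parity_inner_fderiv_gpForce]
  rw [integral_const_mul, integral_add i2001 i12, integral_add i20 i01]
  simp only [Fin.sum_univ_three]
  have hπ : 0 < Real.pi := Real.pi_pos
  nlinarith

/-! ## The enstrophy series and summability of the charge series -/

/-- The enstrophy series in `ℝ`: for `‖∇u‖² < ∞`, `Σₖ |k|² ‖û(k)‖² = ‖∇u‖²/(4π²)`
(`Torus.eGradNormSq_eq_tsum`). [folklore] -/
theorem form2_enstrophy_hasSum {u : Vec3} (hfin : Torus.eGradNormSq u ≠ ⊤) :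
    HasSum (fun k => Torus.freqNormSq k * ‖mFourierCoeff (EuclideanSpace.complexify ∘ u) k‖ ^ 2)
      ((Torus.eGradNormSq u).toReal / (4 * Real.pi ^ 2)) := by
  have hterm : ∀ k : Fin 3 → ℤ, ENNReal.ofReal (Torus.freqNormSq k) *
      ‖mFourierCoeff (EuclideanSpace.complexify ∘ u) k‖ₑ ^ 2 ≠ ⊤ := fun k =>
    ENNReal.mul_ne_top ENNReal.ofReal_ne_top (ENNReal.pow_ne_top enorm_ne_top)
  have htermR : ∀ k : Fin 3 → ℤ, (ENNReal.ofReal (Torus.freqNormSq k) *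
      ‖mFourierCoeff (EuclideanSpace.complexify ∘ u) k‖ₑ ^ 2).toReal =
      Torus.freqNormSq k * ‖mFourierCoeff (EuclideanSpace.complexify ∘ u) k‖ ^ 2 := fun k => by
    rw [ENNReal.toReal_mul, ENNReal.toReal_ofReal (Torus.freqNormSq_nonneg k), ENNReal.toReal_pow,
      toReal_enorm]
  have hT : ∑' k : Fin 3 → ℤ, ENNReal.ofReal (Torus.freqNormSq k) *
      ‖mFourierCoeff (EuclideanSpace.complexify ∘ u) k‖ₑ ^ 2 ≠ ⊤ := by
    intro hT
    apply hfin
    rw [Torus.eGradNormSq_eq_tsum, hT, ENNReal.mul_top (ENNReal.ofReal_pos.2 (by positivity)).ne']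
  have h1 : (Torus.eGradNormSq u).toReal / (4 * Real.pi ^ 2) =
      ∑' k, Torus.freqNormSq k * ‖mFourierCoeff (EuclideanSpace.complexify ∘ u) k‖ ^ 2 := by
    rw [Torus.eGradNormSq_eq_tsum, ENNReal.toReal_mul, ENNReal.toReal_ofReal (by positivity),
      ENNReal.tsum_toReal_eq hterm]
    simp_rw [htermR]
    rw [mul_div_cancel_left₀ _ (by positivity)]
  rw [h1]
  exact ((ENNReal.summable_toReal hT).congr htermR).hasSum

/-- Summability of a weighted component series `Σ_p W(p, e(p)) |ûᵢ(p)|²` for a weight of growth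
`W(p, ·) ≤ 2 + |p|²`, from Parseval and the finiteness of the enstrophy. [folklore] -/
theorem form2_summable (W : (Fin 3 → ℤ) → (Fin 3 → ℤ) → ℝ) (hW0 : ∀ p q, 0 ≤ W p q)
    (hW2 : ∀ p q, W p q ≤ 2 + Torus.freqNormSq p) {u : Vec3} (hu : MemLp u 2 volume)
    (hfin : Torus.eGradNormSq u ≠ ⊤) (i : Fin 3) (e : (Fin 3 → ℤ) → (Fin 3 → ℤ)) :
    Summable (fun p => W p (e p) * ‖mFourierCoeff (fun x => (u x i : ℂ)) p‖ ^ 2) := by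
  have hui : Integrable u volume := hu.integrable one_le_two
  have hP := (Torus.hasSum_sq_norm_mFourierCoeff (Torus.memLp_ofReal_apply hu i)).summable
  have hG := (form2_enstrophy_hasSum hfin).summable
  have hle : ∀ p, ‖mFourierCoeff (fun x => (u x i : ℂ)) p‖ ^ 2 ≤
      ‖mFourierCoeff (EuclideanSpace.complexify ∘ u) p‖ ^ 2 := fun p => by
    rw [← Torus.mFourierCoeff_complexify_apply hui, EuclideanSpace.norm_sq_eq]
    exact Finset.single_le_sum
      (f := fun m => ‖(mFourierCoeff (EuclideanSpace.complexify ∘ u) p) m‖ ^ 2)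
      (fun m _ => sq_nonneg _) (Finset.mem_univ i)
  refine Summable.of_nonneg_of_le (fun p => mul_nonneg (hW0 _ _) (sq_nonneg _)) (fun p => ?_)
    ((hP.mul_left 2).add hG)
  calc W p (e p) * ‖mFourierCoeff (fun x => (u x i : ℂ)) p‖ ^ 2
      ≤ (2 + Torus.freqNormSq p) * ‖mFourierCoeff (fun x => (u x i : ℂ)) p‖ ^ 2 :=
        mul_le_mul_of_nonneg_right (hW2 _ _) (sq_nonneg _)
    _ = 2 * ‖mFourierCoeff (fun x => (u x i : ℂ)) p‖ ^ 2 +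
          Torus.freqNormSq p * ‖mFourierCoeff (fun x => (u x i : ℂ)) p‖ ^ 2 := by ring
    _ ≤ 2 * ‖mFourierCoeff (fun x => (u x i : ℂ)) p‖ ^ 2 +
          Torus.freqNormSq p * ‖mFourierCoeff (EuclideanSpace.complexify ∘ u) p‖ ^ 2 :=
        add_le_add le_rfl (mul_le_mul_of_nonneg_left (hle p) (Torus.freqNormSq_nonneg p))

/-! ## Assembly -/

/-- **The `1/12` bound on `L²` fields with vanishing zero mode and transversal coefficients**: for
`u ∈ L²(T³; ℝ³)` with `û(0) = 0`, `k · û(k) = 0` for all `k` and `‖∇u‖² < ∞`,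
`∫ ⟪∇f_GP u, u⟫ ≥ -(1/12) ‖∇u‖²`. [folklore] -/
theorem form2_pairing_ge_enstrophy {u : Vec3} (hu : MemLp u 2 volume)
    (hU0 : mFourierCoeff (EuclideanSpace.complexify ∘ u) 0 = 0)
    (hdiv : ∀ k : Fin 3 → ℤ,
      ∑ j, (k j : ℂ) * mFourierCoeff (EuclideanSpace.complexify ∘ u) k j = 0)
    (hfin : Torus.eGradNormSq u ≠ ⊤) :
    -(1 / 12 * (Torus.eGradNormSq u).toReal) ≤ ∫ x, ⟪Torus.fderiv gpForce x (u x), u x⟫_ℝ := by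
  obtain ⟨W, hW0, hW2, hW1, hW4, hW5⟩ := form2_weight_exists
  have hui : Integrable u volume := hu.integrable one_le_two
  have hπ : 0 < Real.pi := Real.pi_pos
  -- the charge series
  have hA' : ∀ j : Fin 3, ∃ a : ℝ, HasSum (fun p => W p (p + Pi.single j 1) *
      ‖mFourierCoeff (fun x => (u x j : ℂ)) p‖ ^ 2) a := fun j =>
    ⟨_, (form2_summable W hW0 hW2 hu hfin j fun p => p + Pi.single j 1).hasSum⟩
  have hB' : ∀ j : Fin 3, ∃ b : ℝ, HasSum (fun p => W p (p - Pi.single j 1) *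
      ‖mFourierCoeff (fun x => (u x (j + 1) : ℂ)) p‖ ^ 2) b := fun j =>
    ⟨_, (form2_summable W hW0 hW2 hu hfin (j + 1) fun p => p - Pi.single j 1).hasSum⟩
  choose A hA using hA'
  choose B hB using hB'
  have h1 := form2_pairing_ge W hW0 hW1 hu hA hB
  -- the budget
  have hcU : ∀ p i, mFourierCoeff (EuclideanSpace.complexify ∘ u) p i =
      mFourierCoeff (fun x => (u x i : ℂ)) p := fun p i => Torus.mFourierCoeff_complexify_apply hui p i
  have hnormU : ∀ p, ‖mFourierCoeff (EuclideanSpace.complexify ∘ u) p‖ ^ 2 =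
      ∑ m, ‖mFourierCoeff (fun x => (u x m : ℂ)) p‖ ^ 2 := fun p => by
    rw [EuclideanSpace.norm_sq_eq]
    exact Finset.sum_congr rfl fun m _ => by rw [hcU]
  have hG : HasSum (fun p => Torus.freqNormSq p * ∑ m, ‖mFourierCoeff (fun x => (u x m : ℂ)) p‖ ^ 2)
      ((Torus.eGradNormSq u).toReal / (4 * Real.pi ^ 2)) := by
    have h := form2_enstrophy_hasSum hfin
    simp only [hnormU] at h
    exact h
  have hS := hasSum_sum fun j (_ : j ∈ Finset.univ) => (hA j).add (hB j)
  have hc0 : ∀ m, mFourierCoeff (fun x => (u x m : ℂ)) 0 = 0 := fun m => by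
    rw [← hcU, hU0]
    rfl
  have hneg : ∀ (p : Fin 3 → ℤ) (m : Fin 3), ‖mFourierCoeff (fun x => (u x m : ℂ)) (-p)‖ =
      ‖mFourierCoeff (fun x => (u x m : ℂ)) p‖ := fun p m => by
    rw [Torus.mFourierCoeff_ofReal_comp, Complex.norm_conj]
  have hdiv' : ∀ p : Fin 3 → ℤ, ∑ i, (p i : ℂ) * mFourierCoeff (fun x => (u x i : ℂ)) p = 0 :=
    fun p => by simpa only [hcU] using hdiv p
  have h2 := form2_budget W hW4 hW5 (fun p i => mFourierCoeff (fun x => (u x i : ℂ)) p) hc0 hneg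
    hdiv' hG hS
  have h3 : Real.pi * ∑ j, (A j + B j) ≤ 1 / 12 * (Torus.eGradNormSq u).toReal :=
    calc Real.pi * ∑ j, (A j + B j)
        ≤ Real.pi * (Real.pi / 3 * ((Torus.eGradNormSq u).toReal / (4 * Real.pi ^ 2))) :=
          mul_le_mul_of_nonneg_left h2 hπ.le
      _ = 1 / 12 * (Torus.eGradNormSq u).toReal := by
          field_simp
          ring
  linarith

/-! ## The stub -/

/-- **Stub `stub_gpParityForm2`** (card `ground-state-jump`, L1″) — EXACT `1–2` BLOCK. For every `v`
in the energy space `H` of `T³` with finite enstrophy, `∫ (v ⊗ v) : ∇f_GP ≥ -(1/12) ‖∇v‖²`: the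
one-shift series of the parity bound, with edge-dependent AM–GM weights and the `24` edges between
the shells `|k|² = 1` and `|k|² = 2` (the top singular block of the strain of `f_GP`) accounted
exactly through reality and the divergence-free constraint `k · v̂(k) = 0` (Leray halving of the
in-plane mass). Certifies the tame defect floor up to mean enstrophy `G₁ < 18`. [folklore] -/
theorem stub_gpParityForm2 : ∀ v : H3, Torus.eGradNormSq ((v : L2) : Vec3) ≠ ⊤ → -(1 / 12 * (Torus.eGradNormSq ((v : L2) : Vec3)).toReal) ≤ Torus.inertialPairing (v : L2) gpForce := by
  intro v hv
  rw [Torus.inertialPairing]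
  have hmem := (Torus.mem_energySpace_iff_holds (v : L2)).1 v.2
  exact form2_pairing_ge_enstrophy (Lp.memLp (v : L2))
    (Torus.mFourierCoeff_complexify_coe_zero_of_mem v.2)
    (Torus.IsWeaklyDivFree.sum_mul_mFourierCoeff_eq_zero (Lp.memLp (v : L2)) hmem.1) hv

end Summit.AnomalousDissipation.AnomalousDissipation.Theorems.EnsembleRigidity.GPTameDefectFloor

end
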